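import Mathlib.CategoryTheory.Galois.Decomposition
import Mathlib.CategoryTheory.Limits.FullSubcategory
import Mathlib.CategoryTheory.Limits.Types.Coproducts
import Mathlib.CategoryTheory.Limits.Constructions.EpiMono

/-!
# Full subcategories of a Galois category stable under the Galois operations are Galois

Mathlib-level lemma for the anabelioid dictionary (`Literature.AnabelianGeometry.Anabelioids`).
Let `C` be a Galois category (Mathlib `GaloisCategory`, i.e. conditions (G1)–(G6) of
[SGA1, Exp. V §4] in Lenstra's form) and `P : ObjectProperty C` a property of objects stable under
the operations those axioms name: terminal object, pullbacks, finite coproducts, quotients by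
finite groups of automorphisms, and passage to subobjects.  Then the full subcategory
`P.FullSubcategory` is a Galois category, and for every fibre functor `F` of `C` the restriction
`P.ι ⋙ F` is a fibre functor (`galoisCategory_fullSubcategory`, `fiberFunctor_fullSubcategory`).

Everything is inherited formally (the inclusion creates the relevant (co)limits) except (G5)
"the fibre functor sends epimorphisms to surjections": an epimorphism *of the subcategory* need
not a priori be one of `C`.  It is surjective on fibres because the subcategory contains, with
`Y`, every connected component `Z ↪ Y`, its complement `Z'` and `(Z ⨿ Z) ⨿ Z'`, which separate the
points of the fibre of `Y` off the image (`surjective_fiber_of_epi_fullSubcategory`).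

The closure hypotheses are stated exactly in the currency of Mathlib's `PreGaloisCategory` /
`FiberFunctor` fields (`ObjectProperty.IsClosedUnderLimitsOfShape (Discrete PEmpty)` and
`WalkingCospan`, `IsClosedUnderColimitsOfShape (Discrete J)` for finite `J` and `(SingleObj G)` for
finite groups `G`, stability under monomorphisms), no more.

Consumers: the named facts `bCat_galoisCategory` (`B(G) = ContAction FintypeCat G` is such a full
subcategory of Mathlib's Galois category `Action FintypeCat G`), `image_galoisCategory`
([GeoAn] Def. 1.1.7) of `Anabelioids/Basic.lean`, and `proSigmaCompletion_galoisCategory`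
([SemiAnbd] Def. 2.9 (ii)) of `Anabelioids/ProSigma.lean`.  Deliberately NOT here: those
applications (each is the verification that its object property is stable under the operations).
-/

namespace Literature.AnabelianGeometry.Anabelioids

open CategoryTheory CategoryTheory.Limits CategoryTheory.PreGaloisCategory

universe w u₂ u₁

variable {C : Type u₁} [Category.{u₂} C] [GaloisCategory C] {P : ObjectProperty C}

/-- In a Galois category the fibres of the two legs of a binary coproduct diagram
`A ⟶ Y ⟵ B` are embedded injectively, disjointly, and cover the fibre of `Y` (the fibre functor
preserves finite coproducts, (G5)). [cite: SGA1, Exp. V §4 (condition (G5))] -/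
theorem fiber_binaryCofan (F : C ⥤ FintypeCat.{w}) [FiberFunctor F] {A B Y : C}
    (m : A ⟶ Y) (u : B ⟶ Y) (hc : IsColimit (BinaryCofan.mk m u)) :
    Function.Injective (F.map m) ∧ Function.Injective (F.map u) ∧
      IsCompl (Set.range (F.map m)) (Set.range (F.map u)) := by
  exact (Types.binaryCofan_isColimit_iff _).mp
    ⟨mapIsColimitOfPreservesOfIsColimit (F ⋙ FintypeCat.incl) m u hc⟩

variable [P.IsClosedUnderLimitsOfShape (Discrete PEmpty.{1})]
  [P.IsClosedUnderLimitsOfShape WalkingCospan]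

/-- Conditions (G1)–(G3) for a full subcategory of a Galois category stable under terminal object,
pullbacks, finite coproducts, quotients by finite groups and subobjects: it is a pre-Galois
category — the inclusion creates the (co)limits of (G1)–(G2), and the complement (G3) of a
subobject, taken in `C`, is a subobject hence lies in the subcategory.
[cite: SGA1, Exp. V §4 (conditions (G1)–(G3))] -/
theorem preGaloisCategory_fullSubcategory
    (hc : ∀ (J : Type) [Finite J], P.IsClosedUnderColimitsOfShape (Discrete J))
    (hq : ∀ (G : Type u₂) [Group G] [Finite G], P.IsClosedUnderColimitsOfShape (SingleObj G))
    (hm : ∀ ⦃X Y : C⦄ (i : X ⟶ Y) [Mono i], P Y → P X) :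
    PreGaloisCategory P.FullSubcategory := by
  have hT : HasTerminal P.FullSubcategory := hasLimitsOfShape_of_closedUnderLimits _ _
  have hPB : HasPullbacks P.FullSubcategory := hasLimitsOfShape_of_closedUnderLimits _ _
  have hFC : HasFiniteCoproducts P.FullSubcategory := ⟨fun n => by
    have := hc (Fin n)
    exact hasColimitsOfShape_of_closedUnderColimits _ _⟩
  exact {
    hasTerminal := hT
    hasPullbacks := hPB
    hasFiniteCoproducts := hFC
    hasQuotientsByFiniteGroups := fun G _ _ => by
      have := hq G
      exact hasColimitsOfShape_of_closedUnderColimits _ _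
    monoInducesIsoOnDirectSummand := fun {X Y} i _ => by
      have : Mono (P.ι.map i) := P.ι.map_mono i
      obtain ⟨Z, u, ⟨hcol⟩⟩ := PreGaloisCategory.monoInducesIsoOnDirectSummand (P.ι.map i)
      have : Mono u := MonoCoprod.binaryCofan_inr _ hcol
      have hZ : P Z := hm u Y.property
      refine ⟨⟨Z, hZ⟩, ObjectProperty.homMk u, ⟨?_⟩⟩
      exact isColimitOfReflectsOfMapIsColimit P.ι _ _ hcol }

omit [P.IsClosedUnderLimitsOfShape (Discrete PEmpty.{1})]
  [P.IsClosedUnderLimitsOfShape WalkingCospan] in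
/-- Key step for (G5): in a Galois category, a morphism between objects of a full subcategory
stable under binary coproducts and subobjects which is an epimorphism *of the subcategory* is
surjective on fibres.  (Test object: `(Z ⨿ Z) ⨿ Z'` for `Z ↪ Y` the connected component of a
point off the image and `Z'` its complement.) [cite: SGA1, Exp. V §4 (condition (G5))] -/
theorem surjective_fiber_of_epi_fullSubcategory
    (hc : ∀ (J : Type) [Finite J], P.IsClosedUnderColimitsOfShape (Discrete J))
    (hm : ∀ ⦃X Y : C⦄ (i : X ⟶ Y) [Mono i], P Y → P X)
    (F : C ⥤ FintypeCat.{w}) [FiberFunctor F]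
    {X Y : P.FullSubcategory} (f : X ⟶ Y) [Epi f] : Function.Surjective (F.map f.hom) := by
  classical
  intro y
  by_contra hy
  -- the connected component `Z ↪ Y` of `y` and its complement `Z'`
  obtain ⟨Z, m, z, hz, hZc, hmZ⟩ := fiber_in_connected_component F Y.obj y
  obtain ⟨Z', u, ⟨hcol⟩⟩ := PreGaloisCategory.monoInducesIsoOnDirectSummand m
  have hu : Mono u := MonoCoprod.binaryCofan_inr _ hcol
  obtain ⟨-, -, hcompl⟩ := fiber_binaryCofan F m u hcol
  -- the image of `f` misses the fibre of `Z`, hence lies in the fibre of `Z'`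
  have hrange : ∀ x, ∃ w, F.map u w = F.map f.hom x := by
    intro x
    have hx : F.map f.hom x ∈ Set.range (F.map m) ⊔ Set.range (F.map u) := by
      rw [hcompl.sup_eq_top]; trivial
    rcases hx with ⟨z₁, hz₁⟩ | ⟨w, hw⟩
    · exfalso
      -- the pullback of `f` and `m` has a point, so its projection to the connected `Z` is
      -- surjective on fibres and `y` is in the image of `f`
      let p := (fiberPullbackEquiv F f.hom m).symm ⟨(x, z₁), hz₁.symm⟩
      have : Nonempty (F.obj (pullback f.hom m)) := ⟨p⟩
      have := hZc
      obtain ⟨q, hq⟩ := surjective_of_nonempty_fiber_of_isConnected F (pullback.snd f.hom m) z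
      apply hy ⟨F.map (pullback.fst f.hom m) q, ?_⟩
      rw [← FintypeCat.comp_apply, ← F.map_comp, pullback.condition, F.map_comp,
        FintypeCat.comp_apply, hq, hz]
    · exact ⟨w, hw⟩
  -- the test object `W = (Z ⨿ Z) ⨿ Z'` lies in the subcategory
  have hZ : P Z := hm m Y.property
  have hZ' : P Z' := hm u Y.property
  have := hc WalkingPair
  have hZZ : P (Z ⨿ Z) := P.prop_colimit (pair Z Z) (by rintro ⟨_ | _⟩ <;> exact hZ)
  have hW : P ((Z ⨿ Z) ⨿ Z') := P.prop_colimit (pair (Z ⨿ Z) Z') (by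
    rintro ⟨_ | _⟩
    · exact hZZ
    · exact hZ')
  let W : P.FullSubcategory := ⟨(Z ⨿ Z) ⨿ Z', hW⟩
  -- two maps `Y ⟶ W` agreeing on `Z'` but not on `Z`
  let G₁ : Y.obj ⟶ (Z ⨿ Z) ⨿ Z' :=
    hcol.desc (BinaryCofan.mk (coprod.inl ≫ coprod.inl) coprod.inr)
  let G₂ : Y.obj ⟶ (Z ⨿ Z) ⨿ Z' :=
    hcol.desc (BinaryCofan.mk (coprod.inr ≫ coprod.inl) coprod.inr)
  have hm₁ : m ≫ G₁ = coprod.inl ≫ coprod.inl := hcol.fac _ ⟨WalkingPair.left⟩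
  have hm₂ : m ≫ G₂ = coprod.inr ≫ coprod.inl := hcol.fac _ ⟨WalkingPair.left⟩
  have hu₁ : u ≫ G₁ = coprod.inr := hcol.fac _ ⟨WalkingPair.right⟩
  have hu₂ : u ≫ G₂ = coprod.inr := hcol.fac _ ⟨WalkingPair.right⟩
  have hfG : f.hom ≫ G₁ = f.hom ≫ G₂ := by
    apply F.map_injective
    ext x
    obtain ⟨w, hw⟩ := hrange x
    simp only [F.map_comp, FintypeCat.comp_apply, ← hw]
    rw [← FintypeCat.comp_apply, ← FintypeCat.comp_apply, ← F.map_comp, ← F.map_comp, hu₁, hu₂]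
  have hG : (ObjectProperty.homMk G₁ : Y ⟶ W) = ObjectProperty.homMk G₂ := by
    rw [← cancel_epi f]
    ext
    exact hfG
  have hG' : G₁ = G₂ := congrArg (fun g => g.hom) hG
  -- hence `coprod.inl = coprod.inr : Z ⟶ Z ⨿ Z`, contradicting that `Z` has a point
  have hinl : (coprod.inl : Z ⟶ Z ⨿ Z) = coprod.inr := by
    rw [← cancel_mono (coprod.inl : Z ⨿ Z ⟶ (Z ⨿ Z) ⨿ Z'), ← hm₁, ← hm₂, hG']
  obtain ⟨-, -, hdisj⟩ := fiber_binaryCofan F (coprod.inl : Z ⟶ Z ⨿ Z) coprod.inr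
    (coprodIsCoprod Z Z)
  have hmem : F.map (coprod.inl : Z ⟶ Z ⨿ Z) z ∈
      Set.range (F.map (coprod.inl : Z ⟶ Z ⨿ Z)) ⊓ Set.range (F.map (coprod.inr : Z ⟶ Z ⨿ Z)) :=
    ⟨⟨z, rfl⟩, ⟨z, by rw [hinl]⟩⟩
  rw [hdisj.inf_eq_bot] at hmem
  exact hmem

/-- Conditions (G4)–(G6) for the restriction of a fibre functor of `C` to a full subcategory
stable under the Galois operations: `P.ι ⋙ F` is a fibre functor (for (G5) see
`surjective_fiber_of_epi_fullSubcategory`). [cite: SGA1, Exp. V §4 (conditions (G4)–(G6))] -/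
theorem fiberFunctor_fullSubcategory
    (hc : ∀ (J : Type) [Finite J], P.IsClosedUnderColimitsOfShape (Discrete J))
    (hq : ∀ (G : Type u₂) [Group G] [Finite G], P.IsClosedUnderColimitsOfShape (SingleObj G))
    (hm : ∀ ⦃X Y : C⦄ (i : X ⟶ Y) [Mono i], P Y → P X)
    (F : C ⥤ FintypeCat.{w}) [FiberFunctor F] :
    letI := preGaloisCategory_fullSubcategory hc hq hm
    FiberFunctor (P.ι ⋙ F) := by
  letI := preGaloisCategory_fullSubcategory hc hq hm
  exact {
    preservesTerminalObjects := inferInstance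
    preservesPullbacks := inferInstance
    preservesFiniteCoproducts := ⟨fun n => by
      have := hc (Fin n)
      infer_instance⟩
    preservesEpis := ⟨fun f _ =>
      ConcreteCategory.epi_of_surjective _ (surjective_fiber_of_epi_fullSubcategory hc hm F f)⟩
    preservesQuotientsByFiniteGroups := fun G _ _ => by
      have := hq G
      infer_instance
    reflectsIsos := inferInstance }

/-- **A full subcategory of a Galois category stable under terminal object, pullbacks, finite
coproducts, quotients by finite groups and subobjects is a Galois category** (with fibre functor
the restriction of any fibre functor of `C`). [cite: SGA1, Exp. V §4 (conditions (G1)–(G6))] -/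
theorem galoisCategory_fullSubcategory
    (hc : ∀ (J : Type) [Finite J], P.IsClosedUnderColimitsOfShape (Discrete J))
    (hq : ∀ (G : Type u₂) [Group G] [Finite G], P.IsClosedUnderColimitsOfShape (SingleObj G))
    (hm : ∀ ⦃X Y : C⦄ (i : X ⟶ Y) [Mono i], P Y → P X) :
    GaloisCategory P.FullSubcategory :=
  { __ := preGaloisCategory_fullSubcategory hc hq hm
    hasFiberFunctor :=
      ⟨P.ι ⋙ GaloisCategory.getFiberFunctor C, ⟨fiberFunctor_fullSubcategory hc hq hm _⟩⟩ }

end Literature.AnabelianGeometry.Anabelioids
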